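import Literature.Analysis.FluidPDE.NSFourierFamily
import Mathlib.Analysis.SpecialFunctions.ExpDeriv
import HarnessLib

/-!
# Time derivatives of all orders of the Picard limit

Fifth file of the Fourier-side construction of Leray's local regular solution
(`Literature.Analysis.FluidPDE.local_regular_solution_exists` in `NSLocalRegular`, the existence half of the named fact
`Literature.Analysis.FluidPDE.local_classical_lerayHopf`). For the fixed point
`v = picardLimit c T a` of the Duhamel map (`NSFourierPicard`) with Schwartz-type data `a`
(every polynomial decay) we prove:

* the **mild ⇒ differential** step: at every frequency `ξ` and every `t ∈ [0, T]`,
  `∂ₜ v(t, ξ) = -c‖ξ‖² v(t, ξ) − N(v(t), v(t))(ξ)` within `[0, T]`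
  (`PicardHyp.hasDerivWithinAt_limit`; the usual computation `e^{-βt}(a − ∫₀ᵗ e^{βs} N ds)`
  with the fundamental theorem of calculus);
* the **bootstrap**: for every `n` there is a family `W₀ = v, W₁, …, W_n` of Fourier-side
  coefficient functions with `∂ₜ W_k = W_{k+1}` within `[0, T]`, every polynomial decay
  uniformly in time and measurable slices (`PicardHyp.exists_family`; induction on `n`:
  `∂ₜ W₀ = -c‖ξ‖² W₀ − N(W, W)₀` and the right-hand side is again a family of order `n` by the
  closure properties of `NSFourierFamily`), and the same for the pressure symbol
  (`PicardHyp.exists_presFamily`).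

These are the Fourier-side statements behind "all `∂ₜᵏ∇ᵐ u`, `∂ₜᵏ∇ᵐ p` exist and are
continuous on `[0, T) × ℝ³`" for Leray's regular solution with Schwartz data (Leray 1934, §19
and pp. 220–221; Ożański–Pooley 2018, Cor. 6.16 and the remark after Def. 6.20).

## References

* J. Leray, Acta Math. 63 (1934), §19, pp. 220–221. [Leray1934]
* W. S. Ożański, B. C. Pooley, LMS LN 452, CUP 2018, Cor. 6.16, Def. 6.20. [OzanskiPooley2018]
* P. G. Lemarié-Rieusset, *The Navier–Stokes problem in the 21st century*, CRC 2016, §8.5.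
-/

noncomputable section

open MeasureTheory Real Set Filter Topology Function
open scoped Convolution ComplexConjugate

namespace Literature.Analysis.FluidPDE.FourierNS

variable {ι : Type*} [Fintype ι] [DecidableEq ι]

section Mild

variable {c T : ℝ} {K₀ : ℕ} {R : ℝ} {a : EuclideanSpace ℝ ι → ι → ℂ}

/-- **Mild ⇒ differential.** The Picard limit `v` satisfies, at every frequency and every
`t ∈ [0, T]`, `∂ₜ v(t, ξ) = -c‖ξ‖² v(t, ξ) − N(v(t), v(t))(ξ)` as a derivative within `[0, T]`
(differentiate `v(t) = e^{-βt} a − e^{-βt} ∫₀ᵗ e^{βs} N(s) ds`, `β = c‖ξ‖²`, by the product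
rule and the fundamental theorem of calculus; Leray 1934, §19; Lemarié-Rieusset 2016, §8.5,
equivalence of mild and differential formulations). [folklore] -/
theorem PicardHyp.hasDerivWithinAt_limit (h : PicardHyp c K₀ R a) (hT : T = picardTime ι c K₀ R)
    (ξ : EuclideanSpace ℝ ι) {t : ℝ} (ht : t ∈ Icc 0 T) :
    HasDerivWithinAt (fun s => picardLimit c T a s ξ)
      (-(c * ‖ξ‖ ^ 2) • picardLimit c T a t ξ - nonlin (picardLimit c T a t) (picardLimit c T a t) ξ)
      (Icc 0 T) t := by
  have hTpos : 0 < T := hT ▸ h.time_pos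
  set v := picardLimit c T a with hv
  set β := c * ‖ξ‖ ^ 2 with hβ
  set N : ℝ → ι → ℂ := fun s => nonlin (v s) (v s) ξ with hN
  have hNc : Continuous N := continuous_nonlin_time h.hK₀ (h.continuous_limit hT) (h.decay_limit hT) ξ
  -- `G s = ∫₀ˢ e^{βσ} N(σ) dσ` and its derivative
  set G : ℝ → ι → ℂ := fun s => ∫ σ in (0 : ℝ)..s, Real.exp (β * σ) • N σ with hG
  have hGi : Continuous fun σ => Real.exp (β * σ) • N σ :=
    (Real.continuous_exp.comp (continuous_const.mul continuous_id)).smul hNc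
  have hG' : ∀ s, HasDerivAt G (Real.exp (β * s) • N s) s := fun s =>
    (hGi.integral_hasStrictDerivAt 0 s).hasDerivAt
  -- the heat factor and its derivative
  have hheat : ∀ s, heat c ξ s = Real.exp (-β * s) := fun s => by simp [heat, hβ]
  have hE' : ∀ s, HasDerivAt (fun s => Real.exp (-β * s)) (-β * Real.exp (-β * s)) s := fun s => by
    have := ((hasDerivAt_id s).const_mul (-β)).exp
    simpa [mul_comm] using this
  -- `F s = e^{-βs} a − e^{-βs} G s` is the Duhamel formula
  set F : ℝ → ι → ℂ := fun s => Real.exp (-β * s) • a ξ - Real.exp (-β * s) • G s with hF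
  have hF' : ∀ s, HasDerivAt F (-β • F s - N s) s := by
    intro s
    have h1 : HasDerivAt (fun s => Real.exp (-β * s) • a ξ) ((-β * Real.exp (-β * s)) • a ξ) s :=
      (hE' s).smul_const _
    have h2 : HasDerivAt (fun s => Real.exp (-β * s) • G s)
        (Real.exp (-β * s) • (Real.exp (β * s) • N s) + (-β * Real.exp (-β * s)) • G s) s :=
      (hE' s).smul (hG' s)
    have h3 : HasDerivAt F ((-β * Real.exp (-β * s)) • a ξ -
        (Real.exp (-β * s) • (Real.exp (β * s) • N s) + (-β * Real.exp (-β * s)) • G s)) s :=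
      h1.sub h2
    have hone : Real.exp (-β * s) * Real.exp (β * s) = 1 := by
      rw [← Real.exp_add]; simp
    have heq : (-β * Real.exp (-β * s)) • a ξ -
        (Real.exp (-β * s) • (Real.exp (β * s) • N s) + (-β * Real.exp (-β * s)) • G s) =
        -β • F s - N s := by
      simp only [hF, smul_sub, smul_smul, hone, one_smul]
      module
    rw [heq] at h3
    exact h3
  -- on `[0, T]`, `v s ξ = F s`
  have hvF : ∀ s ∈ Icc 0 T, v s ξ = F s := by
    intro s hs
    have hfix := h.fixed hT s ξ
    change picardLimit c T a s ξ = F s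
    rw [hfix, duhamel, clamp_of_mem hs, hheat]
    have hint : (∫ σ in (0 : ℝ)..s, heat c ξ (s - σ) • nonlin (picardLimit c T a σ)
        (picardLimit c T a σ) ξ) = Real.exp (-β * s) • G s := by
      simp only [hG]
      rw [← intervalIntegral.integral_smul]
      refine intervalIntegral.integral_congr fun σ _ => ?_
      change heat c ξ (s - σ) • N σ = Real.exp (-β * s) • (Real.exp (β * σ) • N σ)
      rw [hheat, smul_smul, ← Real.exp_add]
      congr 1; ring_nf
    rw [hint]
  have key := (hF' t).hasDerivWithinAt (s := Icc 0 T)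
  rw [← hvF t ht] at key
  exact key.congr (fun s hs => hvF s hs) (hvF t ht)

/-- Componentwise form of `PicardHyp.hasDerivWithinAt_limit`. [folklore] -/
theorem PicardHyp.hasDerivWithinAt_limit_apply (h : PicardHyp c K₀ R a) (hT : T = picardTime ι c K₀ R)
    (ξ : EuclideanSpace ℝ ι) {t : ℝ} (ht : t ∈ Icc 0 T) (l : ι) :
    HasDerivWithinAt (fun s => picardLimit c T a s ξ l)
      (-((c * ‖ξ‖ ^ 2 : ℝ) : ℂ) * picardLimit c T a t ξ l -
        nonlin (picardLimit c T a t) (picardLimit c T a t) ξ l) (Icc 0 T) t := by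
  have := hasDerivWithinAt_pi.1 (h.hasDerivWithinAt_limit hT ξ ht) l
  simpa [Complex.real_smul] using this

end Mild

/-! ### The bootstrap: families of all orders for the Picard limit -/

section Bootstrap

variable {c T : ℝ} {K₀ : ℕ} {R : ℝ} {a : EuclideanSpace ℝ ι → ι → ℂ}

/-- Prepending a zeroth member to a family. [folklore] -/
def consFamily (v : ℝ → EuclideanSpace ℝ ι → ι → ℂ) (D : ℕ → ℝ → EuclideanSpace ℝ ι → ι → ℂ) :
    ℕ → ℝ → EuclideanSpace ℝ ι → ι → ℂ
  | 0 => v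
  | k + 1 => D k

omit [Fintype ι] [DecidableEq ι] in
/-- The zeroth member of `consFamily v D` is `v`. [folklore] -/
@[simp] theorem consFamily_zero (v : ℝ → EuclideanSpace ℝ ι → ι → ℂ)
    (D : ℕ → ℝ → EuclideanSpace ℝ ι → ι → ℂ) : consFamily v D 0 = v := rfl

omit [Fintype ι] [DecidableEq ι] in
/-- The later members of `consFamily v D` are the `D k`. [folklore] -/
@[simp] theorem consFamily_succ (v : ℝ → EuclideanSpace ℝ ι → ι → ℂ)
    (D : ℕ → ℝ → EuclideanSpace ℝ ι → ι → ℂ) (k : ℕ) : consFamily v D (k + 1) = D k := rfl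

omit [DecidableEq ι] in
/-- The heat symbol `-c‖ξ‖²` (as a complex number) has quadratic growth. [folklore] -/
theorem norm_heatSymbol_le (hc : 0 ≤ c) (ξ : EuclideanSpace ℝ ι) :
    ‖(-((c * ‖ξ‖ ^ 2 : ℝ) : ℂ))‖ ≤ c * (1 + ‖ξ‖) ^ 2 := by
  rw [norm_neg, Complex.norm_real, Real.norm_of_nonneg (by positivity)]
  gcongr
  linarith [norm_nonneg ξ]

/-- **Families of all orders.** If the datum has every polynomial decay, then for every `n` the
Picard limit `v` is the zeroth member of a vector family `W₀ = v, …, W_n` all of whose components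
are Fourier families of order `n` on `[0, T]` (`∂ₜ W_k = W_{k+1}` within `[0, T]`, every decay,
measurable slices): induction on `n` via `∂ₜ v = -c‖ξ‖² v − N(v, v)` and the closure of
families under the heat symbol and the nonlinearity (Leray 1934, pp. 220–221; Ożański–Pooley
2018, Cor. 6.16). [folklore] -/
theorem PicardHyp.exists_family (h : PicardHyp c K₀ R a) (hT : T = picardTime ι c K₀ R)
    (hall : ∀ K : ℕ, ∃ A, HasDecay K A a) (n : ℕ) :
    ∃ W : ℕ → ℝ → EuclideanSpace ℝ ι → ι → ℂ, W 0 = picardLimit c T a ∧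
      ∀ l, IsFourierFamily T n (fun k t ξ => W k t ξ l) := by
  have hTpos : 0 < T := hT ▸ h.time_pos
  set v := picardLimit c T a with hv
  have hvc := h.continuous_limit hT
  have hvs : ∀ t, Continuous (v t) := fun t => hvc.uncurry_left t
  -- order zero: the constant family `v`
  have base : ∀ l, IsFourierFamily T 0 (fun _ t ξ => v t ξ l) := fun l =>
    { meas := fun k _ t _ => aesm_apply (hvs t).aestronglyMeasurable l
      decay := fun k _ K => by
        obtain ⟨A, hA⟩ := hall K
        exact ⟨2 * A * Real.exp (highRate ι c K K₀ R * T), fun t _ =>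
          (h.decay_limit_high' hT hA t).apply l⟩
      cont := fun k _ ξ => by
        have : Continuous fun t => v t ξ l :=
          (continuous_apply l).comp (hvc.comp (continuous_id.prodMk continuous_const))
        exact this.continuousOn
      deriv := fun k hk => absurd hk (Nat.not_lt_zero k) }
  induction n with
  | zero => exact ⟨fun _ => v, rfl, base⟩
  | succ n ih =>
    obtain ⟨W, hW0, hW⟩ := ih
    -- the right-hand side family `D_k = -c‖ξ‖² W_k − N(W, W)_k`
    set D : ℕ → ℝ → EuclideanSpace ℝ ι → ι → ℂ := fun k t ξ l =>
      -((c * ‖ξ‖ ^ 2 : ℝ) : ℂ) * W k t ξ l - nonlinFamily W W k t ξ l with hD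
    have hD_fam : ∀ l, IsFourierFamily T n (fun k t ξ => D k t ξ l) := fun l => by
      have h1 : IsFourierFamily T n (fun k t ξ => -((c * ‖ξ‖ ^ 2 : ℝ) : ℂ) * W k t ξ l) :=
        (hW l).symbol (m := fun ξ => -((c * ‖ξ‖ ^ 2 : ℝ) : ℂ))
          (by fun_prop : Continuous fun ξ : EuclideanSpace ℝ ι =>
            -((c * ‖ξ‖ ^ 2 : ℝ) : ℂ)).aestronglyMeasurable (d := 2) (M := c) h.hc.le
          (norm_heatSymbol_le h.hc.le)
      have h2 : IsFourierFamily T n (fun k t ξ => nonlinFamily W W k t ξ l) :=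
        IsFourierFamily.nonlinFamily hTpos hW hW l
      exact h1.sub h2
    refine ⟨consFamily v D, rfl, fun l => ?_⟩
    refine ⟨fun k hk t ht => ?_, fun k hk K => ?_, fun k hk ξ => ?_, fun k hk ξ t ht => ?_⟩
    · cases k with
      | zero => exact (base l).meas 0 le_rfl t ht
      | succ k => exact (hD_fam l).meas k (by omega) t ht
    · cases k with
      | zero => exact (base l).decay 0 le_rfl K
      | succ k => exact (hD_fam l).decay k (by omega) K
    · cases k with
      | zero => exact (base l).cont 0 le_rfl ξ
      | succ k => exact (hD_fam l).cont k (by omega) ξ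
    · cases k with
      | zero =>
        -- `∂ₜ v = D₀ = -c‖ξ‖² v − N(v,v)`
        have hd := h.hasDerivWithinAt_limit_apply hT ξ ht l
        simp only [consFamily_zero, consFamily_succ, zero_add]
        convert hd using 1
        simp only [hD, hW0, nonlinFamily_zero, hv]
      | succ k =>
        simp only [consFamily_succ]
        exact (hD_fam l).deriv k (by omega) ξ t ht

/-- **Pressure families of all orders**: with `W` as in `exists_family`, the pressure symbol
family `q_k = presFamily W W k` is a Fourier family of order `n` with
`q₀(t) = presSymbol (v t) (v t)`. [folklore] -/
theorem PicardHyp.exists_presFamily (h : PicardHyp c K₀ R a) (hT : T = picardTime ι c K₀ R)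
    (hall : ∀ K : ℕ, ∃ A, HasDecay K A a) (n : ℕ) :
    ∃ Q : ℕ → ℝ → EuclideanSpace ℝ ι → ℂ,
      (∀ t ξ, Q 0 t ξ = presSymbol (picardLimit c T a t) (picardLimit c T a t) ξ) ∧
      IsFourierFamily T n Q := by
  have hTpos : 0 < T := hT ▸ h.time_pos
  obtain ⟨W, hW0, hW⟩ := h.exists_family hT hall n
  refine ⟨presFamily W W, fun t ξ => ?_, IsFourierFamily.presFamily hTpos hW hW⟩
  rw [presFamily_zero, hW0]

end Bootstrap

end Literature.Analysis.FluidPDE.FourierNS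

end
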